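import Summits.BirchSwinnertonDyer.BirchSwinnertonDyer.Theorems.ResidualThetaTransportAtTwoThetaLayerLambdaCongruenceAtTwoHeckeAdjointTranspose
import Literature.NumberTheory.EllipticCurves.ModularJacobianMultiplicityOneCosocleProofs
import HarnessLib

/-!
# Crux Kan⁺ `ThetaLayerLambdaCongruenceAtTwo` (stmt-BirchSwinnertonDyer-20688), SD floor: SOCLE = COSOCLE for `J₀(N)` is now UNCONDITIONAL,
# and the two readings of Buzzard 2000 Prop. 2.4 (Albanese carrier `J₀(N)[𝔪]` / Picard carrier `Λ/𝔪Λ`) are EQUIVALENT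
# (width seat bsd-wall-rtt-p3-w3 g11; `--supports stmt-BirchSwinnertonDyer-20688`; THEOREMS ONLY — no `def`, no named-fact hypothesis, no `sorry`)

HONEST FRAMING. With IP (`ip_of_crossingPairing_flagSides`) a kernel theorem, the tree's conditional socle/cosocle comparison
`J0.finrank_torsionBySet_eq_finrank_quotient` (Darmon–Diamond–Taylor Thm. 4.26, p. 134: `dim J₀(N)[𝔪] = dim Λ/𝔪Λ`) holds outright at
EVERY level `N ≥ 1`, every prime `ℓ` and every maximal `𝔪 ∋ ℓ` of `𝕋_ℤ`. Consequently the typing question raised for the alias item 27798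
(`buzzard2000_multiplicityOne_gamma0`: is Buzzard's `J(Γ)[𝔪]` to be read on the Albanese torus `S₂^∨/Λ` or on the Picard side `Λ/𝔪Λ`?) is
immaterial in the tree: the two readings are equivalent by name (`buzzard2000_multiplicityOne_gamma0_iff_cosocle`). Nothing here proves
Buzzard's theorem; Kan⁺ is NOT settled; BSD is not proved by any of this.

References: H. Darmon, F. Diamond, R. Taylor, Fermat's Last Theorem (1995), §4.5 Thm. 4.26, pp. 133–134 [DarmonDiamondTaylor1995];
K. Buzzard, On level-lowering for mod 2 representations, Math. Res. Lett. 7 (2000), Prop. 2.4, Def. 2.1–2.2 [Buzzard2000LevelLoweringModTwo];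
J. Tilouine, Hecke algebras and the Gorenstein property (1997), Thm. 3.4 [Tilouine1997Gorenstein].
-/

set_option autoImplicit false

noncomputable section

-- justification: the `Summit.BirchSwinnertonDyer.BirchSwinnertonDyer.…` path repeats a component (route-file convention)
set_option linter.dupNamespace false

open scoped MatrixGroups ModularForm NumberField
open CongruenceSubgroup Polynomial IsDedekindDomain Rat.HeightOneSpectrum
  Literature.NumberTheory.GaloisRepresentations Literature.NumberTheory.EllipticCurves.ModularForms

namespace Summit.BirchSwinnertonDyer.BirchSwinnertonDyer.Theorems.ThetaLayerLambdaCongruenceAtTwo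

/-- **`#J₀(N)[𝔪] = #(Λ/𝔪Λ)`, unconditionally**: for every `N ≥ 1`, prime `ℓ` and ideal `𝔪 ∋ ℓ` of `𝕋_ℤ`, the `𝔪`-torsion of `J₀(N)`
(socle side) and the `𝔪`-co-invariants of the period homology (cosocle side) have the same size (the tree's
`J0.natCard_torsionBySet_eq_natCard_quotient` with its pairing hypothesis discharged by `ip_of_crossingPairing_flagSides`).
[cite: DarmonDiamondTaylor1995, §4.5 Thm. 4.26 and pp. 133–134] -/
theorem J0_natCard_torsionBySet_eq_natCard_periodHomology_quotient (N : ℕ) [NeZero N] (ℓ : ℕ) [Fact ℓ.Prime]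
    (𝔪 : Ideal (HeckeRing0 N 2)) (h𝔪 : (ℓ : HeckeRing0 N 2) ∈ 𝔪) :
    Nat.card (Submodule.torsionBySet (HeckeRing0 N 2) (J0 N) 𝔪) =
      Nat.card (periodHomologyHecke N ⧸ 𝔪 • (⊤ : Submodule (HeckeRing0 N 2) (periodHomologyHecke N))) :=
  J0.natCard_torsionBySet_eq_natCard_quotient N ip_of_crossingPairing_flagSides ℓ 𝔪 h𝔪

/-- **SOCLE = COSOCLE for `J₀(N)`, unconditionally**: `dim_{𝕋/𝔪} J₀(N)[𝔪] = dim_{𝕋/𝔪} Λ/𝔪Λ` for every `N ≥ 1`, prime `ℓ` and maximal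
`𝔪 ∋ ℓ` of `𝕋_ℤ` — Darmon–Diamond–Taylor's «`dim J₀(N)[𝔪] = dim (T_ℓ J₀(N)/𝔪)`», valid for every `ℓ` including `2` (the tree's
`J0.finrank_torsionBySet_eq_finrank_quotient` with its pairing hypothesis discharged by `ip_of_crossingPairing_flagSides`).
[cite: DarmonDiamondTaylor1995, §4.5 Thm. 4.26 and pp. 133–134] [cite: Tilouine1997Gorenstein, Thm. 3.4, Cor. (1)–(3)] -/
theorem J0_finrank_torsionBySet_eq_finrank_periodHomology_quotient (N : ℕ) [NeZero N] (ℓ : ℕ) [Fact ℓ.Prime]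
    (𝔪 : Ideal (HeckeRing0 N 2)) [𝔪.IsMaximal] (h𝔪 : (ℓ : HeckeRing0 N 2) ∈ 𝔪) :
    Module.finrank (HeckeRing0 N 2 ⧸ 𝔪) (Submodule.torsionBySet (HeckeRing0 N 2) (J0 N) 𝔪) =
      Module.finrank (HeckeRing0 N 2 ⧸ 𝔪)
        (periodHomologyHecke N ⧸ 𝔪 • (⊤ : Submodule (HeckeRing0 N 2) (periodHomologyHecke N))) :=
  J0.finrank_torsionBySet_eq_finrank_quotient N ip_of_crossingPairing_flagSides ℓ 𝔪 h𝔪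

/-- **The two readings of Buzzard 2000 Prop. 2.4 are equivalent in the tree.** The named fact `buzzard2000_multiplicityOne_gamma0`
(conclusion `dim_{𝕋/𝔪} J₀(N)[𝔪] = 2`, Albanese carrier) is equivalent to the same statement with conclusion `dim_{𝕋/𝔪} Λ/𝔪Λ = 2`
(Picard / cosocle carrier, hypotheses VERBATIM), by `J0_finrank_torsionBySet_eq_finrank_periodHomology_quotient` at `ℓ = 2`. This proves
neither side. [cite: Buzzard2000LevelLoweringModTwo, Prop. 2.4 and Def. 2.1–2.2 (p. 100–101)] [cite: DarmonDiamondTaylor1995, §4.5 (pp. 133–134)] -/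
theorem buzzard2000_multiplicityOne_gamma0_iff_cosocle :
    buzzard2000_multiplicityOne_gamma0 ↔
      ∀ (N : ℕ) [NeZero N], Odd N →
      ∀ (𝔪 : Ideal (HeckeRing0 N 2)), 𝔪.IsMaximal → (2 : HeckeRing0 N 2) ∈ 𝔪 →
      ∀ (k : Type) [Field k] [IsAlgClosed k] [TopologicalSpace k] [DiscreteTopology k]
        (ι : HeckeRing0 N 2 ⧸ 𝔪 →+* k) (ρ : ModPGaloisRep ℚ k 2),
        (∀ v : HeightOneSpectrum (𝓞 ℚ), ¬ ((primesEquiv v : Nat.Primes) : ℕ) ∣ 2 * N →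
          ρ.IsUnramifiedAt v ∧
            ρ.HasFrobCharpolyAt v
              (X ^ 2
                - C (ι (Ideal.Quotient.mk 𝔪 (HeckeRing0.T N 2
                    ((primesEquiv v : Nat.Primes) : ℕ) (primesEquiv v : Nat.Primes).2))) * X
                + C (((primesEquiv v : Nat.Primes) : ℕ) : k))) →
        FramedRep.IsIrreducible ρ →
        (∀ v : HeightOneSpectrum (𝓞 ℚ), ((primesEquiv v : Nat.Primes) : ℕ) = 2 →
          ∀ 𝔓 ∈ v.primesAbove, ∃ σ ∈ 𝔓.decompositionSubgroup (Field.absoluteGaloisGroup ℚ),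
            ∀ c : k, ((ρ σ : GL (Fin 2) k) : Matrix (Fin 2) (Fin 2) k) ≠ Matrix.scalar (Fin 2) c) →
        Module.finrank (HeckeRing0 N 2 ⧸ 𝔪)
          (periodHomologyHecke N ⧸ (𝔪 • ⊤ : Submodule (HeckeRing0 N 2) (periodHomologyHecke N))) = 2 := by
  haveI : Fact (Nat.Prime 2) := ⟨Nat.prime_two⟩
  constructor
  · intro hBz N _ hN 𝔪 h𝔪 h2 k _ _ _ _ ι ρ hU hI hS
    haveI := h𝔪
    exact finrank_periodHomology_quotient_eq_two_of_buzzard hBz ip_of_crossingPairing_flagSides N hN 𝔪 h2 k ι ρ hU hI hS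
  · intro hPic N _ hN 𝔪 h𝔪 h2 k _ _ _ _ ι ρ hU hI hS
    haveI := h𝔪
    rw [J0_finrank_torsionBySet_eq_finrank_periodHomology_quotient N 2 𝔪 (by exact_mod_cast h2)]
    exact hPic N hN 𝔪 h𝔪 h2 k ι ρ hU hI hS

end Summit.BirchSwinnertonDyer.BirchSwinnertonDyer.Theorems.ThetaLayerLambdaCongruenceAtTwo

end
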